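import Summits.HodgeConjecture.HodgeConjecture.Theorems.Ring2WeilCoverageCMFieldCellsInhabited
import Literature.AlgebraicGeometry.ComplexMultiplication.CMTypeConjugateIsogeny
import Literature.NumberTheory.ComplexMultiplication.CMTypeBasic
import Literature.AlgebraicGeometry.HodgeTheory.WeilClassesFieldAllOrNothing
import Literature.AlgebraicGeometry.Deligne1982.WeilTypeCMWeilClassesHodge
import HarnessLib

/-!
# Ring 2 — Weil-type family-coverage census, CM-field rows (X-B): the CM POWER member `B^p × (B^ρ)^p` on EVERY
# δ-row, and the non-vacuity of the δ-cells `WeilClassesComponentCM R e₀ p δ`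

HONEST FRAMING: research route conditional on HC_CM; not a corollary; Q11.4-sentence-2 already refuted in dim ≥ 3.

Cell `pub-hodge-ring2`, seat `ring2-b03` (gen 55), census `WEIL-FAMILY-COVERAGE.md` «## b03» (CM fields `[E:ℚ] > 2`),
sequel of part X-A (`Ring2WeilCoverageCMFieldCellsInhabited`: Deligne 1982 §5 (c) with an ARBITRARY target class).
THEOREMS ONLY: no `def`, no named fact, no `sorry`. `HC_CM` (`Theses.RankFourFaces.CMAbelianHodge`) does not occur in
this file, and nothing here is a case of the Hodge conjecture.

* §1 `exists_cmPower_hasWeilDiscriminantCM` — the census's member ITSELF (b03.6, Deligne §5 (c)): for `K` Galois CM,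
  `[K:ℚ] = 2e₀ > 2`, Deligne's presentation `(b₀, R)`, ONE realisation `(B, ι, θ)` of a CM type `Ψ`, every `p ≥ 1`
  and EVERY `δ ∈ F^×/Nm_{E/F}(E^×)`: on the POWER `A = ⨁_{j < 2p} B = B^{2p}`, with `𝓞_K` acting through `ι` on the
  first `p` slots and through `ι ∘ c` (complex conjugation; `IsCMTypeRealisation.comp_complexConj`: the SAME variety
  realises the conjugate type `Ψ̄ = CMTypeOps.bar Ψ`) on the last `p` — i.e. `B^p × (B^ρ)^p` — the diagonal
  `η = ⊕ act_j(b₀)` is of Weil type and carries a polarization class `h_δ`, Rosati-compatible, of discriminant `δ`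
  (part X-A §1 at the constant-sum family `Ψ, …, Ψ, Ψ̄, …, Ψ̄`). `exists_presentation_forall_cmPower_of_isGalois`: the
  presentation PRODUCED from `K`; `exists_cmEightfold_hasWeilDiscriminantCM_of_finrank_eq_four`: the rows `W8.E.δ`.
* §2 `weilClassesComponentCM_nonvacuous` — in the vocabulary of the cells: for every `δ` the hypothesis tuple of
  `WeilClassesComponentCM R e₀ p δ` is met by a CM member together with a NON-ZERO rational `(p,p)` Weil class
  (Moonen–Zarhin §1 / Deligne Prop. 4.4 on the carriers): no δ-cell over a Galois CM field speaks about the empty set;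
  `exists_cmMember_weilClass_algebraic_of_weilClassesComponentCM` — what the cell then says at that member.
* Part X-C (`Ring2WeilCoverageCMFieldCellsHodgeAtMember`): for NONDEGENERATE types the Hodge conjecture HOLDS at the
  power member (Pohlmann / Kubota / Yanai in the tree), so the cell's conclusion is TRUE there — cyclic quartic and
  degree-`2ℓ` (`ℓ` odd prime) Galois CM fields.

HONEST COLUMN: as in part X-A — `IsPolarizationClass` records no positivity (every `δ` is reached, including the
classes of the wrong sign at the real places, whose rows are EMPTY for polarized members); `[IsGalois ℚ K]` inherited;
the `D₄` census field is not covered.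

## References
* [Deligne1982HodgeCycles] P. Deligne (notes by J. S. Milne), LNM 900 (1982), §4 p. 30 (1), Prop. 4.4, Lemma 4.6;
  §5 (b)–(c) pp. 38–39.
* [Shimura1998] G. Shimura, *Abelian Varieties with Complex Multiplication and Modular Functions* (1998), §5.2 (2),
  §6.2 Thm. 3, §8.4.
* [MoonenZarhin1998WeilClasses] B. Moonen, Yu. Zarhin, J. reine angew. Math. 496 (1998), §1.
-/

noncomputable section

set_option linter.dupNamespace false

namespace Summit.HodgeConjecture.HodgeConjecture.Ring2.WeilCoverageCM

open CategoryTheory CategoryTheory.Limits Polynomial NumberField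
open Literature.AlgebraicTopology.SingularHomology
open Literature.AlgebraicGeometry Literature.AlgebraicGeometry.Motives Literature.AlgebraicGeometry.HodgeTheory
open Literature.AlgebraicGeometry.ComplexMultiplication Literature.AlgebraicGeometry.Deligne1982
open Literature.AlgebraicGeometry.Milne1999
open Literature.AlgebraicGeometry.VanGeemen1994 (pullbackOne)
open Literature.NumberTheory.ComplexMultiplication (CMTypeOps.bar CMTypeOps.mem_bar_iff CMTypeOps.conjugate_mem_iff_notMem)
open Summit.HodgeConjecture.CorCM.AndreProductForm (diagHom dim_eq_of_isCMTypeRealisation)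
open Summit.HodgeConjecture.CorCM.AndreSplit
open Summit.HodgeConjecture.HodgeConjecture.Ring2.Hypotheses (RosatiCompatible WeilClassesComponentCM)

/-! ## §1 The CM power member `B^p × (B^ρ)^p` on every δ-row -/

section Power

variable (K : Type) [Field K] [NumberField K] [IsCMField K] [IsGalois ℚ K]

/-- `#{j < 2p | j < p} = p` in `Fin (2p)`. [folklore] -/
private theorem card_filter_val_lt_of_two_mul (p : ℕ) :
    ((Finset.univ : Finset (Fin (2 * p))).filter fun j : Fin (2 * p) => (j : ℕ) < p).card = p := by
  refine Finset.card_eq_of_bijective (fun i (hi : i < p) => (⟨i, by omega⟩ : Fin (2 * p))) (fun a ha => ?_)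
    (fun i hi => ?_) fun i j hi hj hij => ?_
  · exact ⟨a, (Finset.mem_filter.1 ha).2, rfl⟩
  · exact Finset.mem_filter.2 ⟨Finset.mem_univ _, hi⟩
  · exact Fin.mk.inj_iff.mp hij

/-- `#{j < 2p | ¬ j < p} = p` in `Fin (2p)`. [folklore] -/
private theorem card_filter_not_val_lt_of_two_mul (p : ℕ) :
    ((Finset.univ : Finset (Fin (2 * p))).filter fun j : Fin (2 * p) => ¬ (j : ℕ) < p).card = p := by
  have h := Finset.card_filter_add_card_filter_not (s := (Finset.univ : Finset (Fin (2 * p))))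
    (fun j : Fin (2 * p) => (j : ℕ) < p)
  rw [card_filter_val_lt_of_two_mul, Finset.card_univ, Fintype.card_fin] at h
  omega

open scoped Classical in
/-- **The census member `B^p × (B^ρ)^p` lies on EVERY row** (b03.6 / Deligne §5 (c) in the kernel). For `K` Galois CM
with `[K:ℚ] > 2`, Deligne's presentation `(b₀, R)`, ONE realisation `(B, ι, θ)` of a CM type `Ψ` of `K`, every `p ≥ 1`
and EVERY `δ ∈ F^×/Nm(E^×)`: on the power `⨁_{j<2p} B` with `𝓞_K` acting by `ι` on the slots `j < p` and by `ι ∘ c`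
on the slots `j ≥ p` (the conjugate type `Ψ̄` on the SAME variety, `IsCMTypeRealisation.comp_complexConj` — Deligne
§5 (b) «`(A_Φ, σι)` is of type `σΦ`»), the diagonal `η = ⊕ act_j(b₀)` is of Weil type `IsWeilTypeCM _ η R e₀ p` and
there is a polarization class `h`, Rosati-compatible with `η`, with `HasWeilDiscriminantCM _ η R e₀ p h δ` (part X-A
§1 at the constant-sum family `Ψ^p, Ψ̄^p`). [cite: Deligne1982HodgeCycles, §5 (b)–(c) pp. 38–39]
[cite: Shimura1998, §5.2 (2)] -/
theorem exists_cmPower_hasWeilDiscriminantCM (hK : 2 < Module.finrank ℚ K)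
    {b₀ : 𝓞 K} (hb₀ : IsCMField.complexConj K (b₀ : K) = -(b₀ : K))
    (hsep : Function.Injective fun σ : K →+* ℂ => σ (b₀ : K))
    {R : Polynomial ℤ} {e₀ : ℕ} (he : Module.finrank ℚ K = 2 * e₀) (hRm : R.Monic) (hRdeg : R.natDegree = e₀)
    (hR : R.comp (X ^ 2) = minpoly ℤ b₀) (hirr : Irreducible (cmPolyQ R))
    (hroots : ∀ s : ℂ, Polynomial.eval₂ (Int.castRingHom ℂ) s R = 0 → s.im = 0 ∧ s.re < 0)
    (haev : Polynomial.aeval (b₀ : K) (cmPolyQ R) = 0) (hdegQ : (cmPolyQ R).natDegree = Module.finrank ℚ K)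
    [Fact (Irreducible (realPolyQ R))]
    {Ψ : CMType K} {B : AbelianVariety ℂ} {ι : 𝓞 K →+* End B} {θ : K →+* Module.End ℂ (complexBetti B.X 1)}
    (hB : IsCMTypeRealisation Ψ B ι θ) {p : ℕ} (hp : 0 < p) (δ : cmNormResidueGroup R) :
    ∃ (act : Fin (2 * p) → (𝓞 K →+* End B)) (h : complexBetti (⨁ fun _ : Fin (2 * p) => B).X 2),
      (∀ j : Fin (2 * p), ((j : ℕ) < p → act j = ι) ∧ (¬ (j : ℕ) < p →
        act j = ι.comp (RingOfIntegers.mapRingHom (IsCMField.complexConj K).toRingEquiv.toRingHom))) ∧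
      IsOfCMType (⨁ fun _ : Fin (2 * p) => B) ∧
      IsWeilTypeCM (⨁ fun _ : Fin (2 * p) => B) (diagHom K (fun _ => B) act b₀) R e₀ p ∧
      IsPolarizationClass (⨁ fun _ : Fin (2 * p) => B).dim (⨁ fun _ : Fin (2 * p) => B).X h ∧
      RosatiCompatible (⨁ fun _ : Fin (2 * p) => B) (diagHom K (fun _ => B) act b₀) h ∧
      HasWeilDiscriminantCM (⨁ fun _ : Fin (2 * p) => B) (diagHom K (fun _ => B) act b₀) R e₀ p h δ := by
  -- the conjugate type on the same variety (Deligne §5 (b))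
  have hbar : ∀ φ : K →+* ℂ, φ ∈ (CMTypeOps.bar Ψ).1 ↔ ComplexEmbedding.conjugate φ ∈ Ψ.1 := fun φ =>
    (CMTypeOps.mem_bar_iff Ψ φ).trans (CMTypeOps.conjugate_mem_iff_notMem Ψ φ).symm
  have hB' := hB.comp_complexConj hbar
  -- the family of actions / `H¹`-actions / types: `Ψ` on the slots `j < p`, `Ψ̄` on the slots `j ≥ p`
  let ιc : 𝓞 K →+* End B := ι.comp (RingOfIntegers.mapRingHom (IsCMField.complexConj K).toRingEquiv.toRingHom)
  let θc : K →+* Module.End ℂ (complexBetti B.X 1) := θ.comp (IsCMField.complexConj K).toRingEquiv.toRingHom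
  let act : Fin (2 * p) → (𝓞 K →+* End B) := fun j => if (j : ℕ) < p then ι else ιc
  let θB : Fin (2 * p) → (K →+* Module.End ℂ (complexBetti B.X 1)) := fun j => if (j : ℕ) < p then θ else θc
  let Φ : Fin (2 * p) → CMType K := fun j => if (j : ℕ) < p then Ψ else CMTypeOps.bar Ψ
  have hreal : ∀ j, IsCMTypeRealisation (Φ j) B (act j) (θB j) := by
    intro j
    by_cases hj : (j : ℕ) < p
    · simp only [Φ, act, θB, if_pos hj]; exact hB
    · simp only [Φ, act, θB, if_neg hj]; exact hB'
  have hmem : ∀ (s : K →+* ℂ) (j : Fin (2 * p)), s ∈ (Φ j).1 ↔ ((j : ℕ) < p ↔ s ∈ Ψ.1) := by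
    intro s j
    by_cases hj : (j : ℕ) < p
    · simp only [Φ, if_pos hj]
      exact ⟨fun h => ⟨fun _ => h, fun _ => hj⟩, fun h => h.1 hj⟩
    · simp only [Φ, if_neg hj]
      rw [CMTypeOps.mem_bar_iff]
      exact ⟨fun h => ⟨fun h' => absurd h' hj, fun h' => absurd h' h⟩, fun h h' => hj (h.2 h')⟩
  have hadm : ∀ s : K →+* ℂ, (Finset.univ.filter fun j : Fin (2 * p) => s ∈ (Φ j).1).card = p := by
    intro s
    by_cases hs : s ∈ Ψ.1
    · have hfilt : (Finset.univ.filter fun j : Fin (2 * p) => s ∈ (Φ j).1) =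
          Finset.univ.filter fun j : Fin (2 * p) => (j : ℕ) < p := by
        refine Finset.filter_congr fun j _ => ?_
        rw [hmem]
        exact ⟨fun h => h.2 hs, fun h => ⟨fun _ => hs, fun _ => h⟩⟩
      rw [hfilt, card_filter_val_lt_of_two_mul]
    · have hfilt : (Finset.univ.filter fun j : Fin (2 * p) => s ∈ (Φ j).1) =
          Finset.univ.filter fun j : Fin (2 * p) => ¬ (j : ℕ) < p := by
        refine Finset.filter_congr fun j _ => ?_
        rw [hmem]
        exact ⟨fun h hj => hs (h.1 hj), fun h => ⟨fun hj => absurd hj h, fun h' => absurd h' hs⟩⟩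
      rw [hfilt, card_filter_not_val_lt_of_two_mul]
  obtain ⟨hW, h, hpol, hros, hdisc⟩ :=
    exists_polarizationClass_hasWeilDiscriminantCM_of_constantSum K hK rfl hp (fun _ => B) act hreal hadm hb₀ hsep
      he hRm hRdeg hR hirr hroots haev hdegQ δ
  refine ⟨act, h, fun j => ⟨fun hj => if_pos hj, fun hj => if_neg hj⟩, ?_, hW, hpol, hros, hdisc⟩
  exact CMCodimTwo.isOfCMType_biproduct_fin (fun _ => B) fun _ => hB.isOfCMType

/-- **The presentation PRODUCED from `K`, and the power member on every row.** For every Galois CM field `K` with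
`[K:ℚ] > 2`: a purely imaginary separating `b₀ ∈ 𝓞_K` with Deligne's presentation `R` (`R(T²) = minpoly_ℤ(b₀)`
irreducible, `R` monic of degree `e₀ = [K:ℚ]/2` with real negative roots; `AndreSplit.exists_imaginary_separating`,
`exists_sq_eq_minpoly`), a CM type `Ψ` realised by `(B, ι, θ)` (Shimura §6.2 Thm. 3, `exists_isCMTypeRealisation`), and
for every `p ≥ 1` and EVERY `δ` the power `B^{2p}` with a Weil-type `η` and a Rosati-compatible polarization class of
discriminant `δ`. [cite: Deligne1982HodgeCycles, §4 p. 30 and §5 (c) pp. 38–39] [cite: Shimura1998, §6.2 Theorem 3] -/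
theorem exists_presentation_forall_cmPower_of_isGalois (hK : 2 < Module.finrank ℚ K) :
    ∃ (b₀ : 𝓞 K) (R : Polynomial ℤ) (e₀ : ℕ) (hF : Irreducible (realPolyQ R)) (Ψ : CMType K) (B : AbelianVariety ℂ)
      (ι : 𝓞 K →+* End B) (θ : K →+* Module.End ℂ (complexBetti B.X 1)),
      IsCMField.complexConj K (b₀ : K) = -(b₀ : K) ∧ (Function.Injective fun σ : K →+* ℂ => σ (b₀ : K)) ∧
      Module.finrank ℚ K = 2 * e₀ ∧ R.Monic ∧ R.natDegree = e₀ ∧ R.comp (X ^ 2) = minpoly ℤ b₀ ∧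
      Irreducible (cmPolyQ R) ∧ (∀ s : ℂ, Polynomial.eval₂ (Int.castRingHom ℂ) s R = 0 → s.im = 0 ∧ s.re < 0) ∧
      IsCMTypeRealisation Ψ B ι θ ∧
      ∀ {p : ℕ}, 0 < p →
        haveI : Fact (Irreducible (realPolyQ R)) := ⟨hF⟩
        ∀ δ : cmNormResidueGroup R,
          ∃ (η : (⨁ fun _ : Fin (2 * p) => B) ⟶ ⨁ fun _ : Fin (2 * p) => B)
            (h : complexBetti (⨁ fun _ : Fin (2 * p) => B).X 2),
            IsOfCMType (⨁ fun _ : Fin (2 * p) => B) ∧ IsWeilTypeCM (⨁ fun _ : Fin (2 * p) => B) η R e₀ p ∧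
            IsPolarizationClass (⨁ fun _ : Fin (2 * p) => B).dim (⨁ fun _ : Fin (2 * p) => B).X h ∧
            RosatiCompatible (⨁ fun _ : Fin (2 * p) => B) η h ∧
            HasWeilDiscriminantCM (⨁ fun _ : Fin (2 * p) => B) η R e₀ p h δ := by
  obtain ⟨b₀, hb₀, hsep⟩ := exists_imaginary_separating K
  obtain ⟨R, e₀, he, hRm, hRdeg, hR, hirr, hroots, haev, hdegQ, -⟩ := exists_sq_eq_minpoly hb₀ hsep
  have hF : Irreducible (realPolyQ R) := by
    have hc : Irreducible ((realPolyQ R).comp (Polynomial.X ^ 2)) := by rw [← cmPolyQ_eq_comp]; exact hirr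
    exact irreducible_of_irreducible_comp_X_sq hc
  obtain ⟨Ψ⟩ := nonempty_cmType_of_isCMField (K := K)
  obtain ⟨B, ι, θ, hB⟩ := exists_isCMTypeRealisation Ψ
  refine ⟨b₀, R, e₀, hF, Ψ, B, ι, θ, hb₀, hsep, he, hRm, hRdeg, hR, hirr, hroots, hB, fun hp => ?_⟩
  haveI : Fact (Irreducible (realPolyQ R)) := ⟨hF⟩
  intro δ
  obtain ⟨act, h, -, hcm, hW, hpol, hros, hdisc⟩ :=
    exists_cmPower_hasWeilDiscriminantCM K hK hb₀ hsep he hRm hRdeg hR hirr hroots haev hdegQ hB hp δ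
  exact ⟨_, h, hcm, hW, hpol, hros, hdisc⟩

/-- **The census rows `W8.E.δ`: a CM EIGHTFOLD `B² × (B^ρ)²` on every row of every quartic Galois CM field.** For `K`
Galois CM with `[K:ℚ] = 4`, Deligne's presentation `(b₀, R)` (`e₀ = 2`, `F = ℚ[S]/(R)` real quadratic), a realisation
`(B, ι, θ)` of a CM type (a CM abelian SURFACE) and EVERY `δ ∈ F^×/Nm_{E/F}(E^×)`: the eightfold `B⁴ = ⨁_{j<4} B` with
the actions `ι, ι, ι∘c, ι∘c` carries a Weil-type `(2,2;2,2)` datum `IsWeilTypeCM _ η R 2 2`, a Rosati-compatible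
polarization class, and `disc = δ`. [cite: Deligne1982HodgeCycles, §5 (c) pp. 38–39] [cite: Shimura1998, §6.2 Theorem 3] -/
theorem exists_cmEightfold_hasWeilDiscriminantCM_of_finrank_eq_four (h4 : Module.finrank ℚ K = 4)
    {b₀ : 𝓞 K} (hb₀ : IsCMField.complexConj K (b₀ : K) = -(b₀ : K))
    (hsep : Function.Injective fun σ : K →+* ℂ => σ (b₀ : K))
    {R : Polynomial ℤ} {e₀ : ℕ} (he : Module.finrank ℚ K = 2 * e₀) (hRm : R.Monic) (hRdeg : R.natDegree = e₀)
    (hR : R.comp (X ^ 2) = minpoly ℤ b₀) (hirr : Irreducible (cmPolyQ R))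
    (hroots : ∀ s : ℂ, Polynomial.eval₂ (Int.castRingHom ℂ) s R = 0 → s.im = 0 ∧ s.re < 0)
    (haev : Polynomial.aeval (b₀ : K) (cmPolyQ R) = 0) (hdegQ : (cmPolyQ R).natDegree = Module.finrank ℚ K)
    [Fact (Irreducible (realPolyQ R))]
    {Ψ : CMType K} {B : AbelianVariety ℂ} {ι : 𝓞 K →+* End B} {θ : K →+* Module.End ℂ (complexBetti B.X 1)}
    (hB : IsCMTypeRealisation Ψ B ι θ) (δ : cmNormResidueGroup R) :
    B.dim = 2 ∧ ∃ (η : (⨁ fun _ : Fin (2 * 2) => B) ⟶ ⨁ fun _ : Fin (2 * 2) => B)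
      (h : complexBetti (⨁ fun _ : Fin (2 * 2) => B).X 2),
      (⨁ fun _ : Fin (2 * 2) => B).dim = 8 ∧ IsOfCMType (⨁ fun _ : Fin (2 * 2) => B) ∧
      IsWeilTypeCM (⨁ fun _ : Fin (2 * 2) => B) η R 2 2 ∧
      IsPolarizationClass (⨁ fun _ : Fin (2 * 2) => B).dim (⨁ fun _ : Fin (2 * 2) => B).X h ∧
      RosatiCompatible (⨁ fun _ : Fin (2 * 2) => B) η h ∧
      HasWeilDiscriminantCM (⨁ fun _ : Fin (2 * 2) => B) η R 2 2 h δ := by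
  have he₀ : e₀ = 2 := by omega
  subst he₀
  refine ⟨by rw [dim_eq_of_isCMTypeRealisation hB, h4], ?_⟩
  obtain ⟨act, h, -, hcm, hW, hpol, hros, hdisc⟩ :=
    exists_cmPower_hasWeilDiscriminantCM K (by omega) hb₀ hsep he hRm hRdeg hR hirr hroots haev hdegQ hB two_pos δ
  exact ⟨_, h, by rw [hW.dim_eq]; rfl, hcm, hW, hpol, hros, hdisc⟩

end Power

/-! ## §2 In the vocabulary of the cells: no δ-cell of the CM-field Weil column is vacuous -/

section Cells

variable (K : Type) [Field K] [NumberField K] [IsCMField K] [IsGalois ℚ K]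

/-- **A Weil-type CM datum carries a NON-ZERO RATIONAL Weil class of type `(p,p)`** on the carriers: `W_E ⊗ ℂ`
(`weilClassesField A η (R(T²)) (2p)`) contains a non-zero rational class (Moonen–Zarhin §1: `W_F` is an `F`-line,
`exists_isRationalClass_ne_zero_mem_weilClassesField` with `2e₀ · 2p = 2 dim A`), and every class of `W_E ⊗ ℂ` is of
type `(p,p)` for a Weil-type datum (Deligne Prop. 4.4, `IsWeilTypeCM.isOfHodgeType_of_mem_weilClassesField'`).
[cite: MoonenZarhin1998WeilClasses, §1] [cite: Deligne1982HodgeCycles, §4 Prop. 4.4] -/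
theorem exists_isRationalClass_ne_zero_weilClass_of_isWeilTypeCM {A : AbelianVariety ℂ} {η : A ⟶ A}
    {R : Polynomial ℤ} {e₀ p : ℕ} (hW : IsWeilTypeCM A η R e₀ p) :
    ∃ c ∈ weilClassesField A η (R.comp (X ^ 2)) (2 * p), IsRationalClass c ∧
      IsOfHodgeType A.dim A.X (2 * p) p p c ∧ c ≠ 0 := by
  have her : (2 * e₀) * (2 * p) = 2 * A.dim := by rw [hW.dim_eq]; ring
  obtain ⟨c, hc, hcQ, hc0⟩ :=
    exists_isRationalClass_ne_zero_mem_weilClassesField hW.monic_comp hW.natDegree_comp hW.irreducible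
      hW.eval₂_eq_zero her
  exact ⟨c, hc, hcQ, hW.isOfHodgeType_of_mem_weilClassesField' hc, hc0⟩

/-- **No δ-cell `WeilClassesComponentCM R e₀ p δ` over a Galois CM field is a statement about the empty set.** For `K`,
`b₀`, `R` as in `exists_cmMember_hasWeilDiscriminantCM`, every `p ≥ 1` and EVERY `δ`: the full hypothesis tuple of the
cell — `IsWeilTypeCM A η R e₀ p`, a polarization class `h`, the Rosati clause, `HasWeilDiscriminantCM A η R e₀ p h δ`, a
class `c ∈ W_E ⊗ ℂ` rational of type `(p,p)` — is satisfied with `A` of CM type and `c ≠ 0`; in particular the cell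
asserts the algebraicity of at least one non-zero class (which, at THIS member, is HC for a power of a CM abelian
variety — the census's print column, not re-proved here). [cite: Deligne1982HodgeCycles, §5 (c) pp. 38–39 and §4 Prop. 4.4]
[cite: MoonenZarhin1998WeilClasses, §1] -/
theorem weilClassesComponentCM_nonvacuous (hK : 2 < Module.finrank ℚ K)
    {b₀ : 𝓞 K} (hb₀ : IsCMField.complexConj K (b₀ : K) = -(b₀ : K))
    (hsep : Function.Injective fun σ : K →+* ℂ => σ (b₀ : K))
    {R : Polynomial ℤ} {e₀ : ℕ} (he : Module.finrank ℚ K = 2 * e₀) (hRm : R.Monic) (hRdeg : R.natDegree = e₀)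
    (hR : R.comp (X ^ 2) = minpoly ℤ b₀) (hirr : Irreducible (cmPolyQ R))
    (hroots : ∀ s : ℂ, Polynomial.eval₂ (Int.castRingHom ℂ) s R = 0 → s.im = 0 ∧ s.re < 0)
    (haev : Polynomial.aeval (b₀ : K) (cmPolyQ R) = 0) (hdegQ : (cmPolyQ R).natDegree = Module.finrank ℚ K)
    [Fact (Irreducible (realPolyQ R))] {p : ℕ} (hp : 0 < p) (δ : cmNormResidueGroup R) :
    ∃ (A : AbelianVariety ℂ) (η : A ⟶ A) (h : complexBetti A.X 2) (c : complexBetti A.X (2 * p)),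
      IsOfCMType A ∧ IsWeilTypeCM A η R e₀ p ∧ IsPolarizationClass A.dim A.X h ∧
      (∀ x y : complexBetti A.X 1,
        polarizationPairingOne A.X h (A.dim - 1) (pullbackOne A η x) y =
          -polarizationPairingOne A.X h (A.dim - 1) x (pullbackOne A η y)) ∧
      HasWeilDiscriminantCM A η R e₀ p h δ ∧
      c ∈ weilClassesField A η (R.comp (X ^ 2)) (2 * p) ∧ IsRationalClass c ∧ IsOfHodgeType A.dim A.X (2 * p) p p c ∧
      c ≠ 0 := by
  obtain ⟨A, η, h, hcm, hW, hpol, hros, hdisc⟩ :=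
    exists_cmMember_hasWeilDiscriminantCM K hK hb₀ hsep he hRm hRdeg hR hirr hroots haev hdegQ hp δ
  obtain ⟨c, hc, hcQ, hcH, hc0⟩ := exists_isRationalClass_ne_zero_weilClass_of_isWeilTypeCM hW
  exact ⟨A, η, h, c, hcm, hW, hpol, hros, hdisc, hc, hcQ, hcH, hc0⟩

/-- **What the cell says at its CM inhabitant.** If `WeilClassesComponentCM R e₀ p δ` holds, then at the CM member of
§2 every rational `(p,p)` class of `W_E ⊗ ℂ` is algebraic — and there IS a non-zero one: the δ-cell has CONTENT at a
member of CM type for every `δ`. [cite: Deligne1982HodgeCycles, §5 (c) pp. 38–39] [cite: MoonenZarhin1998WeilClasses, §1] -/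
theorem exists_cmMember_weilClass_algebraic_of_weilClassesComponentCM (hK : 2 < Module.finrank ℚ K)
    {b₀ : 𝓞 K} (hb₀ : IsCMField.complexConj K (b₀ : K) = -(b₀ : K))
    (hsep : Function.Injective fun σ : K →+* ℂ => σ (b₀ : K))
    {R : Polynomial ℤ} {e₀ : ℕ} (he : Module.finrank ℚ K = 2 * e₀) (hRm : R.Monic) (hRdeg : R.natDegree = e₀)
    (hR : R.comp (X ^ 2) = minpoly ℤ b₀) (hirr : Irreducible (cmPolyQ R))
    (hroots : ∀ s : ℂ, Polynomial.eval₂ (Int.castRingHom ℂ) s R = 0 → s.im = 0 ∧ s.re < 0)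
    (haev : Polynomial.aeval (b₀ : K) (cmPolyQ R) = 0) (hdegQ : (cmPolyQ R).natDegree = Module.finrank ℚ K)
    [Fact (Irreducible (realPolyQ R))] {p : ℕ} (hp : 0 < p) (δ : cmNormResidueGroup R)
    (hcell : WeilClassesComponentCM R e₀ p δ) :
    ∃ (A : AbelianVariety ℂ) (η : A ⟶ A) (c : complexBetti A.X (2 * p)),
      IsOfCMType A ∧ IsWeilTypeCM A η R e₀ p ∧
      c ∈ weilClassesField A η (R.comp (X ^ 2)) (2 * p) ∧ IsRationalClass c ∧ c ≠ 0 ∧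
      c ∈ algebraicClasses A.X p := by
  obtain ⟨A, η, h, c, hcm, hW, hpol, hros, hdisc, hc, hcQ, hcH, hc0⟩ :=
    weilClassesComponentCM_nonvacuous K hK hb₀ hsep he hRm hRdeg hR hirr hroots haev hdegQ hp δ
  exact ⟨A, η, c, hcm, hW, hc, hcQ, hc0, hcell A η h hW hpol hros hdisc c hc hcQ hcH⟩

end Cells

end Summit.HodgeConjecture.HodgeConjecture.Ring2.WeilCoverageCM

end
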